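import Mathlib
import Summits.Ventures.LatticeQCDFlow.Scaling.TorusSlabCost
import Summits.Ventures.LatticeQCDFlow.Scaling.U1SlabChain
import Summits.Ventures.LatticeQCDFlow.Scaling.SlabChainCovariance
import Summits.Ventures.LatticeQCDFlow.Scaling.CrossCutFloorOfLeadingCoeff

/-!
# LatticeQCDFlow / Scaling — (LC) AT EVERY SEPARATION FOR `U(1)` and (U′) AT STRONG COUPLING
# FOR EVERY `R`: the cross-cut plaquette–plaquette correlator floor, uniformly in the volume

HONEST FRAMING: exact (Metropolis-corrected) sampling algorithms for lattice gauge theory;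
figures of merit are autocorrelation/cost numbers at stated couplings and volumes; no
continuum-physics claim.

Venture `LatticeQCDFlow` (cell pub-lqcd), topic `Scaling`, FANOUT row 30 (lean-1) — OUR WORK (LEAD
LINE 230 (G3′)), the assembly of the slab-chain proof.  The torus plaquette system
`torusSystem u1Rep (L+1)` of side `L+1` is read, through the section `torusSigma` and the height
reading `heightCfg` along the axis `a` (`Scaling/TorusHeightDecomposition.lean`), as the `U(1)` slab
chain `u1Chain d L a` (`Scaling/TorusSlabCost.lean`); its complex expectations are tilted ratios
of the chain (`expect_heightCfg_eq`), the chain meets the hypotheses of THE SLAB-CHAIN THEOREM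
`SlabChain.cov_tilt_jetEq` (`Scaling/SlabChainCovariance.lean`) with `g = 4`, the centred order-four
kernel `rho4` and the constants `momentConst`, `c4` (`Scaling/U1SlabMoments.lean`, girth `L+1 ≥ 4`),
and the two plaquette observables of the crux are the layer cosines `xObs` at heights `0` and `t`
(`plaquetteObs_torusRed_eq_xObs`, `plaquetteObs_configShift_torusRed_eq_xObs`).  Hence
* **`torusTruncC_leadingCoeff_u1`** — hypothesis (LC) of theory2's items 120 / 121 at EVERY
  separation `t ≥ 1` for `G = U(1)`: for every torus side `L+1` with `L ≥ max 3 (2t)`, every `d`,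
  `i < j`, `a ∉ {i, j}`:  `torusTruncC u1Rep (L+1) P P (t·e_a) β − 2^{-(4t+1)} β^{4t} = O(β^{4t+1})`
  at `β = 0` (`P = plaquetteObs u1Rep 0 i j`), the leading coefficient being the tube number
  `(1/16)^t · (1/2)` of `Scaling/U1SlabChain.integral_chain_xObs`;
* **`crossCutCorrelatorFloor_u1_all`**, **`crossCutCorrelatorFloorR_u1_all`** — for EVERY `R`,
  there is ONE `β₀ > 0` such that `Conjectures.CrossCutCorrelatorFloor d 1 Circle u1Rep β R i j a`
  (and the repaired item `…FloorR`) holds for every real `β ≠ 0` with `|β| ≤ β₀`: hypothesis (U′)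
  of the volume law at strong coupling for `U(1)` at every separation `2R+1`, with NO physics
  input (item 121's bridge `crossCutCorrelatorFloor_of_leadingCoeff`).
The printed leading tube [cite: MontvayMunster1994, §3.6.2 (3.437)].  What is NOT claimed:
`SU(N)` (the abstract slab-chain theorem applies verbatim; the `SU(N)` one-link integrals of order
`≤ 4` are the missing input), intermediate `β`.  Elementary given the imports; nothing is cited as a
fact; `def`s `HCfg`, `obsX`, `obsXY`, `u1Moment`; no `sorry`.
-/

noncomputable section

open MeasureTheory Filter Topology Asymptotics Finset
open scoped Nat
open Literature.MathematicalPhysics.QuantumFieldTheory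
open Literature.MathematicalPhysics.QuantumLattice (u1Rep u1Rep_apply continuous_u1Rep plaquetteObs
  configShift toTorusObservable toTorusObservable_apply)
open Literature.Probability.LatticeModels (Torus.proj Torus.proj_apply)
open Summit.Ventures.LatticeQCDFlow.Theory2.Tilted
open Summit.Ventures.LatticeQCDFlow.Theory2.Lattice.U1Torus (holT cosT torusCost_u1Rep_eq)

namespace Summit.Ventures.LatticeQCDFlow.Theory2.Lattice.U1Layer

variable {d n : ℕ} {a i j : Fin d}

/-! ## 1. The `U(1)` slab chain meets the hypotheses of the slab-chain theorem -/

/-- The height configurations: layer variables and vertical variables by height. [folklore] -/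
abbrev HCfg (d n : ℕ) (a : Fin d) : Type :=
  (Fin (n + 1) → LEdge d (n + 1) a → Circle) × (Fin (n + 1) → LSite d (n + 1) a → Circle)

/-- A horizontal plaquette cosine is continuous in the layer variables. [folklore] -/
theorem continuous_hplaqCos (y : LSite d (n + 1) a) {k l : Fin d} (hk : k ≠ a) (hl : l ≠ a) :
    Continuous fun e : LEdge d (n + 1) a → Circle => hplaqCos e y k l hk hl := by
  have h : Continuous fun e : LEdge d (n + 1) a → Circle =>
      (e ⟨(y, k), hk⟩ * e ⟨(LEdge.tgt ⟨(y, k), hk⟩, l), hl⟩ *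
        (e ⟨(LEdge.tgt ⟨(y, l), hl⟩, k), hk⟩)⁻¹ * (e ⟨(y, l), hl⟩)⁻¹ : Circle) := by
    fun_prop
  exact Complex.continuous_re.comp (continuous_subtype_val.comp h)

/-- The in-layer cost is continuous. [folklore] -/
theorem continuous_layerCost : Continuous (layerCost (n := n) a) := by
  unfold layerCost
  refine continuous_finsetSum _ fun y _ => continuous_finsetSum _ fun k _ =>
    continuous_finsetSum _ fun l _ => ?_
  by_cases h : k < l ∧ k ≠ a ∧ l ≠ a
  · simp only [dif_pos h]; exact continuous_hplaqCos y h.2.1 h.2.2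
  · simp only [dif_neg h]; exact continuous_const

/-- `|hplaqCos| ≤ 1`. [folklore] -/
theorem abs_hplaqCos_le (e : LEdge d (n + 1) a → Circle) (y : LSite d (n + 1) a) {k l : Fin d}
    (hk : k ≠ a) (hl : l ≠ a) : |hplaqCos e y k l hk hl| ≤ 1 :=
  (Complex.abs_re_le_norm _).trans (le_of_eq (Circle.norm_coe _))

/-- The in-layer cost is bounded. [folklore] -/
theorem abs_layerCost_le (e : LEdge d (n + 1) a → Circle) :
    |layerCost a e| ≤ Fintype.card (LSite d (n + 1) a) * (Fintype.card (Fin d) * (Fintype.card (Fin d) * 1)) := by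
  -- `|Σ f| ≤ #type · C` when `|f| ≤ C` termwise
  have hs : ∀ {α : Type} [Fintype α] {f : α → ℝ} {C : ℝ}, (∀ x, |f x| ≤ C) →
      |∑ x, f x| ≤ Fintype.card α * C := fun h =>
    (Finset.abs_sum_le_sum_abs _ _).trans ((Finset.sum_le_sum fun x _ => h x).trans (by simp))
  unfold layerCost
  refine hs fun y => hs fun k => hs fun l => ?_
  by_cases h : k < l ∧ k ≠ a ∧ l ≠ a
  · rw [dif_pos h]; exact abs_hplaqCos_le e y h.2.1 h.2.2
  · rw [dif_neg h]; simp

/-- **The bounds** of the `U(1)` slab chain. [folklore] -/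
theorem u1Chain_bounds : (u1Chain d n a).Bounds
    ((Fintype.card (LSite d (n + 1) a) : ℝ) * (Fintype.card (Fin d) * (Fintype.card (Fin d) * 1)))
    (Fintype.card (LEdge d (n + 1) a)) where
  a_meas := fun _ => continuous_layerCost.measurable
  s_meas := fun _ => continuous_slabCost.measurable
  a_bound := fun _ e => abs_layerCost_le e
  s_bound := fun _ e w e' => abs_slabCost_le e w e'
  Ma_nonneg := by positivity
  Ms_nonneg := Nat.cast_nonneg _

/-- The vertical moment constants of the `U(1)` slab chain: `momentConst` below order four, `c4`
at order four. [folklore] -/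
def u1Moment (d n : ℕ) (a : Fin d) (_h : Fin (n + 1)) (m : ℕ) : ℂ :=
  if m ≤ 3 then momentConst d (n + 1) a m else c4 d (n + 1) a

/-- **The moment hypothesis of order four** for the `U(1)` slab chain (girth: `n + 1 ≥ 4`). [folklore] -/
theorem u1Chain_moments (hn : 3 ≤ n) : (u1Chain d n a).Moments
    (Measure.pi fun _ : LSite d (n + 1) a => haarProbability Circle) 4 (u1Moment d n a)
    (fun _ => rho4) where
  low := fun h m hm e e' => by
    have hm3 : m ≤ 3 := by omega
    rw [u1Moment, if_pos hm3]
    exact integral_slabCost_pow_eq_const (by omega) hm3 e e'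
  top := fun h e e' => by
    rw [u1Moment, if_neg (by omega)]
    exact integral_slabCost_pow_four e e'

/-! ## 2. Torus expectations are tilted ratios of the slab chain -/

/-- **The height reading of the torus Haar product is the product law of the chain.** [folklore] -/
theorem measurePreserving_heightCfg_torusSigma (a : Fin d) :
    MeasurePreserving (fun U : ZdGaugeConfig d Circle => heightCfg a (torusSigma (n + 1) U))
      (zdHaar d Circle)
      ((Measure.pi fun _ : Fin (n + 1) =>
          Measure.pi fun _ : LEdge d (n + 1) a => haarProbability Circle).prod
        (Measure.pi fun _ : Fin (n + 1) =>
          Measure.pi fun _ : LSite d (n + 1) a => haarProbability Circle)) :=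
  (measurePreserving_heightCfg a).comp ⟨measurable_torusSigma (n + 1), map_torusSigma_zdHaar⟩

/-- The total cost of the genuine torus plaquettes, read by heights. [folklore] -/
theorem sum_torusCost_eq (U : ZdGaugeConfig d Circle) :
    ∑ p ∈ torusGenuine d (n + 1), ((torusSystem u1Rep (n + 1)).cost p U : ℂ) =
      ((torusGenuine d (n + 1)).card : ℂ) -
        ((u1Chain d n a).cost (heightCfg a (torusSigma (n + 1) U)) : ℂ) := by
  rw [← sum_plaquetteCos_eq_cost (a := a) (torusSigma (n + 1) U)]
  simp only [torusSystem_cost, torusCost_u1Rep_eq]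
  push_cast
  rw [Finset.sum_sub_distrib, Finset.sum_const, nsmul_eq_mul, mul_one]
  rfl

/-- **`numZ = e^{-β #V} · tilt`** for observables read by heights. [folklore] -/
theorem numZ_heightCfg_eq (Φ : HCfg d n a → ℂ) (hΦ : Measurable Φ) (β : ℂ) :
    (torusSystem u1Rep (n + 1)).numZ (fun U => Φ (heightCfg a (torusSigma (n + 1) U)))
        (torusGenuine d (n + 1)) β =
      Complex.exp (-(β * (torusGenuine d (n + 1)).card)) *
        tilt ((Measure.pi fun _ : Fin (n + 1) =>
            Measure.pi fun _ : LEdge d (n + 1) a => haarProbability Circle).prod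
          (Measure.pi fun _ : Fin (n + 1) =>
            Measure.pi fun _ : LSite d (n + 1) a => haarProbability Circle))
          (u1Chain d n a).cost Φ β := by
  rw [PlaqSystem.numZ_eq_integral_exp, tilt]
  simp_rw [sum_torusCost_eq (a := a)]
  have hΘ := measurePreserving_heightCfg_torusSigma (d := d) (n := n) a
  have hg : Measurable fun ω : HCfg d n a =>
      Complex.exp (-(β * (torusGenuine d (n + 1)).card)) *
        (Φ ω * Complex.exp (β * ((u1Chain d n a).cost ω : ℂ))) :=
    measurable_const.mul (hΦ.mul (Complex.measurable_exp.comp (measurable_const.mul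
      (Complex.measurable_ofReal.comp (SlabChain.measurable_cost u1Chain_bounds)))))
  rw [← integral_const_mul, ← hΘ.map_eq, integral_map hΘ.measurable.aemeasurable hg.aestronglyMeasurable]
  refine integral_congr_ae (Eventually.of_forall fun U => ?_)
  beta_reduce
  rw [show -(β * (((torusGenuine d (n + 1)).card : ℂ) -
      ((u1Chain d n a).cost (heightCfg a (torusSigma (n + 1) U)) : ℂ))) =
      -(β * (torusGenuine d (n + 1)).card) +
        β * ((u1Chain d n a).cost (heightCfg a (torusSigma (n + 1) U)) : ℂ) by ring, Complex.exp_add]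
  ring

/-- **Torus expectations of observables read by heights are tilted ratios of the chain**:
`⟨Φ∘Θ⟩_V(β) = ∫ Φ e^{βC} / ∫ e^{βC}`. [folklore] -/
theorem expect_heightCfg_eq (Φ : HCfg d n a → ℂ) (hΦ : Measurable Φ) (β : ℂ) :
    (torusSystem u1Rep (n + 1)).expect (fun U => Φ (heightCfg a (torusSigma (n + 1) U)))
        (torusGenuine d (n + 1)) β =
      tilt ((Measure.pi fun _ : Fin (n + 1) =>
            Measure.pi fun _ : LEdge d (n + 1) a => haarProbability Circle).prod
          (Measure.pi fun _ : Fin (n + 1) =>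
            Measure.pi fun _ : LSite d (n + 1) a => haarProbability Circle))
          (u1Chain d n a).cost Φ β /
        tilt ((Measure.pi fun _ : Fin (n + 1) =>
            Measure.pi fun _ : LEdge d (n + 1) a => haarProbability Circle).prod
          (Measure.pi fun _ : Fin (n + 1) =>
            Measure.pi fun _ : LSite d (n + 1) a => haarProbability Circle))
          (u1Chain d n a).cost (fun _ => 1) β := by
  have h1 : (torusSystem u1Rep (n + 1)).partZ (torusGenuine d (n + 1)) β = _ :=
    numZ_heightCfg_eq (a := a) (fun _ : HCfg d n a => (1 : ℂ)) measurable_const β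
  rw [PlaqSystem.expect, h1, numZ_heightCfg_eq Φ hΦ, mul_div_mul_left _ _ (Complex.exp_ne_zero _)]

/-! ## 3. The plaquette observables of the crux are layer cosines -/

/-- **The periodised plaquette at the origin is the layer cosine at height `0`.** [folklore] -/
theorem plaquetteObs_torusRed_eq_xObs (hi : i ≠ a) (hj : j ≠ a) (U : ZdGaugeConfig d Circle) :
    plaquetteObs u1Rep 0 i j (U ∘ torusRed (n + 1)) =
      xObs hi hj (layerCfg a (torusSigma (n + 1) U) 0) := by
  have h1 : plaquetteObs u1Rep 0 i j (U ∘ torusRed (n + 1)) =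
      toTorusObservable (n + 1) (plaquetteObs u1Rep 0 i j) (torusSigma (n + 1) U) := rfl
  rw [h1, toTorusObservable_plaquetteObs]
  dsimp only
  rw [show ∀ g : Circle, (u1Rep g).trace.re = ((g : ℂ)).re from fun g => by simp]
  have h0 : (Torus.proj (n + 1) (0 : Literature.Probability.LatticeModels.Site d) : Site d (n + 1)) =
      Function.update (0 : Site d (n + 1)) a (-(toZ (0 : Fin (n + 1)))) := by
    rw [toZ_zero, neg_zero,
      (Function.update_eq_self_iff (f := (0 : Site d (n + 1))) (a := a) (b := 0)).2 rfl]
    funext k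
    simp [Torus.proj_apply]
  rw [h0]
  exact pcos_axisSite_eq_xObs hi hj _ 0

/-- **The periodised plaquette translated by `t·e_a` is the layer cosine at height `t`.** [folklore] -/
theorem plaquetteObs_configShift_torusRed_eq_xObs (hi : i ≠ a) (hj : j ≠ a)
    (U : ZdGaugeConfig d Circle) (τ : Fin (n + 1)) :
    plaquetteObs u1Rep 0 i j (configShift (Pi.single a (τ.val : ℤ)) (U ∘ torusRed (n + 1))) =
      xObs hi hj (layerCfg a (torusSigma (n + 1) U) τ) := by
  have h1 : plaquetteObs u1Rep 0 i j (configShift (Pi.single a (τ.val : ℤ)) (U ∘ torusRed (n + 1))) =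
      toTorusObservable (n + 1) (plaquetteObs u1Rep 0 i j ∘ configShift (Pi.single a (τ.val : ℤ)))
        (torusSigma (n + 1) U) := rfl
  rw [h1, toTorusObservable_plaquetteObs_comp_configShift]
  dsimp only
  rw [show ∀ g : Circle, (u1Rep g).trace.re = ((g : ℂ)).re from fun g => by simp, zero_sub, torusProj_neg_single_natCast,
    show -Pi.single a ((τ.val : ℕ) : ZMod (n + 1)) = Function.update (0 : Site d (n + 1)) a (-(toZ τ))
      from (update_zero_eq_neg_single τ).symm]
  exact pcos_axisSite_eq_xObs hi hj _ τ

/-- The layer-cosine observable `ω ↦ xObs(η_h)` (complex-valued). [folklore] -/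
def obsX (hi : i ≠ a) (hj : j ≠ a) (h : Fin (n + 1)) (ω : HCfg d n a) : ℂ :=
  ((xObs hi hj (ω.1 h) : ℝ) : ℂ)

/-- The product observable `ω ↦ xObs(η_h) xObs(η_h')` (complex-valued). [folklore] -/
def obsXY (hi : i ≠ a) (hj : j ≠ a) (h h' : Fin (n + 1)) (ω : HCfg d n a) : ℂ :=
  ((xObs hi hj (ω.1 h) * xObs hi hj (ω.1 h') : ℝ) : ℂ)

/-- `obsX` is measurable. [folklore] -/
theorem measurable_obsX (hi : i ≠ a) (hj : j ≠ a) (h : Fin (n + 1)) :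
    Measurable (obsX (d := d) (n := n) hi hj h) :=
  Complex.measurable_ofReal.comp ((continuous_xObs hi hj).measurable.comp
    ((measurable_pi_apply h).comp measurable_fst))

/-- `obsXY` is measurable. [folklore] -/
theorem measurable_obsXY (hi : i ≠ a) (hj : j ≠ a) (h h' : Fin (n + 1)) :
    Measurable (obsXY (d := d) (n := n) hi hj h h') :=
  Complex.measurable_ofReal.comp (((continuous_xObs hi hj).measurable.comp
    ((measurable_pi_apply h).comp measurable_fst)).mul ((continuous_xObs hi hj).measurable.comp
    ((measurable_pi_apply h').comp measurable_fst)))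

/-! ## 4. (LC) at every separation and (U′) for every `R` -/

/-- **(LC) AT EVERY SEPARATION FOR `U(1)`.**  For the torus plaquette system of side `L + 1`,
`L ≥ 3`, `L ≥ 2t`, in any dimension, directions `i < j`, `a ∉ {i, j}`, separation `t ≥ 1`, and
`P` the periodised `U(1)` plaquette observable at the origin in the `(i, j)` plane:
`torusTruncC u1Rep (L+1) P P (t·e_a) β − 2^{-(4t+1)} β^{4t} = O(β^{4t+1})` at `β = 0`. [folklore] -/
theorem torusTruncC_leadingCoeff_u1 (hij : i < j) (hai : a ≠ i) (haj : a ≠ j) {t : ℕ} (ht : 1 ≤ t)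
    (L : ℕ) (hL3 : 3 ≤ L) (hLt : 2 * t ≤ L) :
    (fun β : ℂ => torusTruncC u1Rep (L + 1) (plaquetteObs u1Rep 0 i j) (plaquetteObs u1Rep 0 i j)
        (Pi.single a (t : ℤ)) β - ((((2 : ℝ) ^ (4 * t + 1))⁻¹ : ℝ) : ℂ) * β ^ (4 * t))
      =O[𝓝 (0 : ℂ)] fun β => β ^ (4 * t + 1) := by
  have hi : i ≠ a := fun h => hai h.symm
  have hj : j ≠ a := fun h => haj h.symm
  have hij' : i ≠ j := hij.ne
  set τ : Fin (L + 1) := ⟨t, by omega⟩ with hτdef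
  have hτv : τ.val = t := rfl
  -- the slab-chain theorem for the `U(1)` chain, with the leading coefficient computed
  have key := SlabChain.cov_tilt_jetEq
    (Measure.pi fun _ : LEdge d (L + 1) a => haarProbability Circle)
    (Measure.pi fun _ : LSite d (L + 1) a => haarProbability Circle)
    (u1Chain_bounds (d := d) (n := L) (a := a)) (u1Chain_moments (by omega)) (by norm_num)
    (fun _ => measurable_rho4) (fun _ e e' => norm_rho4_le e e')
    (fun _ e' => integral_rho4_left e') (fun _ e => integral_rho4_right e)
    (continuous_xObs hi hj).measurable (continuous_xObs hi hj).measurable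
    (abs_xObs_le hi hj) (abs_xObs_le hi hj) (τ := τ) (by omega) (by omega)
  rw [integral_chain_xObs hi hj hij' (by omega) (by omega : 1 ≤ τ.val)] at key
  -- the three torus expectations are tilted ratios of the chain
  have fX : (fun U : ZdGaugeConfig d Circle =>
      ((plaquetteObs u1Rep 0 i j (U ∘ torusRed (L + 1)) : ℝ) : ℂ)) =
      fun U => obsX hi hj 0 (heightCfg a (torusSigma (L + 1) U)) := by
    funext U
    show _ = ((xObs hi hj (layerCfg a (torusSigma (L + 1) U) 0) : ℝ) : ℂ)
    rw [plaquetteObs_torusRed_eq_xObs hi hj U]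
  have fY : (fun U : ZdGaugeConfig d Circle =>
      ((plaquetteObs u1Rep 0 i j (configShift (Pi.single a (t : ℤ)) (U ∘ torusRed (L + 1))) : ℝ) : ℂ)) =
      fun U => obsX hi hj τ (heightCfg a (torusSigma (L + 1) U)) := by
    funext U
    show _ = ((xObs hi hj (layerCfg a (torusSigma (L + 1) U) τ) : ℝ) : ℂ)
    rw [← plaquetteObs_configShift_torusRed_eq_xObs hi hj U τ]
  have fXY : (fun U : ZdGaugeConfig d Circle =>
      ((plaquetteObs u1Rep 0 i j (U ∘ torusRed (L + 1)) : ℝ) : ℂ) *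
        ((plaquetteObs u1Rep 0 i j (configShift (Pi.single a (t : ℤ)) (U ∘ torusRed (L + 1))) : ℝ) : ℂ)) =
      fun U => obsXY hi hj 0 τ (heightCfg a (torusSigma (L + 1) U)) := by
    funext U
    show _ = ((xObs hi hj (layerCfg a (torusSigma (L + 1) U) 0) *
      xObs hi hj (layerCfg a (torusSigma (L + 1) U) τ) : ℝ) : ℂ)
    rw [plaquetteObs_torusRed_eq_xObs hi hj U, ← plaquetteObs_configShift_torusRed_eq_xObs hi hj U τ]
    push_cast
    rfl
  have eT : ∀ β : ℂ, torusTruncC u1Rep (L + 1) (plaquetteObs u1Rep 0 i j) (plaquetteObs u1Rep 0 i j)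
      (Pi.single a (t : ℤ)) β =
      tilt ((Measure.pi fun _ : Fin (L + 1) =>
            Measure.pi fun _ : LEdge d (L + 1) a => haarProbability Circle).prod
          (Measure.pi fun _ : Fin (L + 1) =>
            Measure.pi fun _ : LSite d (L + 1) a => haarProbability Circle))
          (u1Chain d L a).cost (obsXY hi hj 0 τ) β /
        tilt ((Measure.pi fun _ : Fin (L + 1) =>
            Measure.pi fun _ : LEdge d (L + 1) a => haarProbability Circle).prod
          (Measure.pi fun _ : Fin (L + 1) =>
            Measure.pi fun _ : LSite d (L + 1) a => haarProbability Circle))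
          (u1Chain d L a).cost (fun _ => 1) β -
      tilt ((Measure.pi fun _ : Fin (L + 1) =>
            Measure.pi fun _ : LEdge d (L + 1) a => haarProbability Circle).prod
          (Measure.pi fun _ : Fin (L + 1) =>
            Measure.pi fun _ : LSite d (L + 1) a => haarProbability Circle))
          (u1Chain d L a).cost (obsX hi hj 0) β /
        tilt ((Measure.pi fun _ : Fin (L + 1) =>
            Measure.pi fun _ : LEdge d (L + 1) a => haarProbability Circle).prod
          (Measure.pi fun _ : Fin (L + 1) =>
            Measure.pi fun _ : LSite d (L + 1) a => haarProbability Circle))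
          (u1Chain d L a).cost (fun _ => 1) β *
      (tilt ((Measure.pi fun _ : Fin (L + 1) =>
            Measure.pi fun _ : LEdge d (L + 1) a => haarProbability Circle).prod
          (Measure.pi fun _ : Fin (L + 1) =>
            Measure.pi fun _ : LSite d (L + 1) a => haarProbability Circle))
          (u1Chain d L a).cost (obsX hi hj τ) β /
        tilt ((Measure.pi fun _ : Fin (L + 1) =>
            Measure.pi fun _ : LEdge d (L + 1) a => haarProbability Circle).prod
          (Measure.pi fun _ : Fin (L + 1) =>
            Measure.pi fun _ : LSite d (L + 1) a => haarProbability Circle))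
          (u1Chain d L a).cost (fun _ => 1) β) := fun β => by
    rw [torusTruncC, fXY, fX, fY, expect_heightCfg_eq _ (measurable_obsXY hi hj 0 τ),
      expect_heightCfg_eq _ (measurable_obsX hi hj 0), expect_heightCfg_eq _ (measurable_obsX hi hj τ)]
  -- the leading coefficient `(1/16)^t / 2 = 2^{-(4t+1)}`
  have hb : (16⁻¹ : ℂ) ^ τ.val * (1 / 2) = ((((2 : ℝ) ^ (4 * t + 1))⁻¹ : ℝ) : ℂ) := by
    rw [hτv]
    push_cast
    rw [pow_succ, pow_mul, show (2 : ℂ) ^ 4 = 16 by norm_num, mul_inv, inv_pow, one_div]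
  unfold JetEq at key
  refine key.congr_left fun β => ?_
  rw [eT β, hb]
  rfl

/-- **(U′) AT STRONG COUPLING FOR `U(1)`, EVERY `R`.**  For `d`-dimensional compact `U(1)` lattice
gauge theory (`i < j`, `a ∉ {i, j}`) and every `R`: there is `β₀ > 0` such that for every real
`β ≠ 0` with `|β| ≤ β₀` the venture's cross-cut correlator floor
`Conjectures.CrossCutCorrelatorFloor d 1 Circle u1Rep β R i j a` holds (all torus sides
`≥ max 3 (2(2R+1)) + 1`, all sites). [folklore] -/
theorem crossCutCorrelatorFloor_u1_all (hij : i < j) (hai : a ≠ i) (haj : a ≠ j) (R : ℕ) :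
    ∃ β₀ : ℝ, 0 < β₀ ∧ ∀ β : ℝ, β ≠ 0 → |β| ≤ β₀ →
      Conjectures.CrossCutCorrelatorFloor d 1 Circle u1Rep β R i j a :=
  crossCutCorrelatorFloor_of_leadingCoeff u1Rep continuous_u1Rep i j a R (n := 4 * (2 * R + 1))
    (b := ((2 : ℝ) ^ (4 * (2 * R + 1) + 1))⁻¹) (by positivity) (max 3 (2 * (2 * R + 1)))
    fun L hL => torusTruncC_leadingCoeff_u1 hij hai haj (t := 2 * R + 1) (by omega) L
      (le_of_max_le_left hL) (le_of_max_le_right hL)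

/-- **The repaired item (U′-R) at strong coupling for `U(1)`, EVERY `R`.** [folklore] -/
theorem crossCutCorrelatorFloorR_u1_all (hij : i < j) (hai : a ≠ i) (haj : a ≠ j) (R : ℕ) :
    ∃ β₀ : ℝ, 0 < β₀ ∧ ∀ β : ℝ, β ≠ 0 → |β| ≤ β₀ →
      Conjectures.CrossCutCorrelatorFloorR d 1 Circle u1Rep β R i j a :=
  crossCutCorrelatorFloorR_of_leadingCoeff u1Rep continuous_u1Rep i j a R (n := 4 * (2 * R + 1))
    (b := ((2 : ℝ) ^ (4 * (2 * R + 1) + 1))⁻¹) (by positivity) (max 3 (2 * (2 * R + 1)))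
    fun L hL => torusTruncC_leadingCoeff_u1 hij hai haj (t := 2 * R + 1) (by omega) L
      (le_of_max_le_left hL) (le_of_max_le_right hL)

end Summit.Ventures.LatticeQCDFlow.Theory2.Lattice.U1Layer

end
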